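import Summits.ValiantsHypothesis.ValiantsHypothesis.Theses.AnyonJets

/-!
# Sandwich theorems for the deciding crux `JetConstantElim` (redirect strategist r1)

Route `route-ValiantsHypothesis-AnyonJets`, crux item `stmt-ValiantsHypothesis-16737`.

Kernel-checked evidence for the STRATEGY-CENSUS verdict.  Writing
`CE := JetConstantElim`, `CF := ConstantFreeJetGrowth`, `U := UniformJetUpperBound`,
`X := JetExponentUnbounded` (the route's target), `G := JetCostGrowthC` (the route's own
"direct, split-free milestone", a support item) and `F := JetFlatness` (support, routine
Valiant-skew-circuit bound), this file proves, sorry-free: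

* `jetConstantElim_of_flat_of_growthC : F → G → CE` — modulo the routine flatness bound, the
  deciding crux is IMPLIED by the direct complex lower bound `G` on the jets (the statement the
  route concedes is subject to the rank-method barriers);
* `jetExponentUnbounded_of_growthC : G → X` — and `G` alone already gives the target;
* `jetExponentUnbounded_of_elim_of_cfGrowth : CE → CF → X` — the two cruxes are JOINTLY the
  target `X` (this is exactly the arithmetic of the certified `closes`);
* `valiantsHypothesis_of_unbounded_of_uniform : X → U → ValiantsHypothesis`;
* `not_cfGrowth_of_elim_of_collapse : CE → U → VP ℂ = VNP ℂ → ¬ CF` — under the collapse the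
  deciding crux forces the FAILURE of its sibling crux;
* `not_cfGrowth_of_uniformTau : UniformTauBound → ¬ CF` and
  `jetConstantElim_of_uniformTau : F → UniformTauBound → CE` — the circuit-free way of proving `CE`
  (a uniform constant-free upper bound on the window) refutes the sibling crux;
* `jetConstantElim_fixedOrder : F → ∀ k, ∃ b, ∀ n, τ ≤ (L+n+2)^b` — every fixed-order truncation
  of `CE` is a triviality.

Reading: `G ∧ F ⟹ CE ⟹ (CF → X) ⟹ (CF → U → VH)`: every known way to make `CE` true passes
through a complex lower bound at least as strong as the target, and `CE` carries no content at any
fixed jet order `k` (there `F` makes it trivially true) — its content is purely the uniformity in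
`k ≤ log₂ n`, for which no constant-elimination technique exists (Koiran–Perifel 2011, Remark 4;
Bürgisser 2009, Thm 2.10 carries the factor `2^{p(n)}`).  See `STRATEGY-CENSUS.md`.
-/

set_option linter.dupNamespace false

namespace Summit.ValiantsHypothesis.ValiantsHypothesis.Cruxes.JetConstantElim.Strategist

open Summit.ValiantsHypothesis.ValiantsHypothesis.Theses.AnyonJets
open Literature.Computability.AlgebraicComplexity

/-! ## The jet family and its two costs (verbatim the `let J` of the route items) -/

/-- The anyonic jet `J n k` — verbatim the `let J := …` shared by every item of the route. -/
noncomputable def jet (n k : ℕ) : MvPolynomial (Fin n × Fin n) ℤ :=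
  ∑ σ : Equiv.Perm (Fin n), MvPolynomial.C (((Equiv.Perm.sign σ : ℤˣ) : ℤ) *
    (((Finset.univ.filter (fun p : Fin n × Fin n => p.1 < p.2 ∧ σ p.2 < σ p.1)).card.choose k : ℕ) : ℤ)) *
    ∏ i : Fin n, MvPolynomial.X (σ i, i)

/-- constant-free cost `τ(J n k)` -/
noncomputable def tau (n k : ℕ) : ℕ := constantFreeComplexity (jet n k)

/-- complex cost `L_ℂ(J n k)` -/
noncomputable def ell (n k : ℕ) : ℕ := complexity (MvPolynomial.map (Int.castRingHom ℂ) (jet n k))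

theorem jetConstantElim_iff :
    JetConstantElim ↔ ∃ b : ℕ, ∀ n k : ℕ, k ≤ Nat.log 2 n → tau n k ≤ (ell n k + n + 2) ^ b :=
  Iff.rfl

theorem jetFlatness_iff :
    JetFlatness ↔ ∃ c₀ : ℕ, ∀ n k : ℕ, tau n k ≤ (n + 2) ^ (4 * k + c₀) * Nat.factorial (2 * k + 2) :=
  Iff.rfl

theorem jetCostGrowthC_iff :
    JetCostGrowthC ↔ ∃ a n₀ : ℕ, ∀ n : ℕ, n₀ ≤ n → ∀ k : ℕ, 1 ≤ k → k ≤ Nat.log 2 n →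
      n ^ k ≤ (ell n k) ^ a :=
  Iff.rfl

theorem constantFreeJetGrowth_iff :
    ConstantFreeJetGrowth ↔ ∀ c : ℕ, ∃ k : ℕ, 1 ≤ k ∧ ∀ n₀ : ℕ, ∃ n : ℕ, n₀ ≤ n ∧ n ^ c ≤ tau n k :=
  Iff.rfl

theorem jetExponentUnbounded_iff :
    JetExponentUnbounded ↔ ∀ c : ℕ, ∃ k : ℕ, ∀ n₀ : ℕ, ∃ n : ℕ, n₀ ≤ n ∧ n ^ c < ell n k :=
  Iff.rfl

theorem uniformJetUpperBound_iff :
    UniformJetUpperBound ↔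
      (VP ℂ = VNP ℂ → ∃ c n₀ : ℕ, ∀ n : ℕ, n₀ ≤ n → ∀ k : ℕ, ell n k ≤ n ^ c) :=
  Iff.rfl

/-! ## Pure arithmetic -/

/-- Arithmetic core of `F → G → CE`: a flat upper bound `τ ≤ (n+2)^(4k+c₀)·(2k+2)!` and a
polynomial-in-`n^k` lower bound on `L` in the window `1 ≤ k ≤ log₂ n` give `τ ≤ (L+n+2)^b`
uniformly in the window (the `+ n + 2` padding absorbs `k = 0` and the finitely many `n < n₀`). -/
theorem elim_of_flat_of_growth (τ L : ℕ → ℕ → ℕ) (c₀ a n₀ : ℕ)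
    (hF : ∀ n k : ℕ, τ n k ≤ (n + 2) ^ (4 * k + c₀) * Nat.factorial (2 * k + 2))
    (hG : ∀ n : ℕ, n₀ ≤ n → ∀ k : ℕ, 1 ≤ k → k ≤ Nat.log 2 n → n ^ k ≤ (L n k) ^ a) :
    ∃ b : ℕ, ∀ n k : ℕ, k ≤ Nat.log 2 n → τ n k ≤ (L n k + n + 2) ^ b := by
  -- a uniform bound for the finitely many exceptional `n < n₀` (there `k ≤ log₂ n ≤ n < n₀`)
  obtain ⟨M, hM⟩ : ∃ M : ℕ, ∀ n k : ℕ, n < n₀ → k ≤ n → τ n k ≤ M := by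
    refine ⟨(n₀ + 2) ^ (4 * n₀ + c₀) * Nat.factorial (2 * n₀ + 2), fun n k hn hk => ?_⟩
    calc τ n k ≤ (n + 2) ^ (4 * k + c₀) * Nat.factorial (2 * k + 2) := hF n k
      _ ≤ (n₀ + 2) ^ (4 * n₀ + c₀) * Nat.factorial (2 * n₀ + 2) := by
        apply Nat.mul_le_mul
        · calc (n + 2) ^ (4 * k + c₀) ≤ (n₀ + 2) ^ (4 * k + c₀) := Nat.pow_le_pow_left (by omega) _
            _ ≤ (n₀ + 2) ^ (4 * n₀ + c₀) := Nat.pow_le_pow_right (by omega) (by omega)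
        · exact Nat.factorial_le (by omega)
  refine ⟨12 * a + (2 * c₀ + 4) + M, fun n k hk => ?_⟩
  have hbase : 2 ≤ L n k + n + 2 := by omega
  have hkn : k ≤ n := hk.trans (Nat.log_le_self 2 n)
  rcases Nat.lt_or_ge n n₀ with hn | hn
  · -- small `n`
    calc τ n k ≤ M := hM n k hn hkn
      _ ≤ 2 ^ M := (Nat.lt_two_pow_self).le
      _ ≤ (L n k + n + 2) ^ M := Nat.pow_le_pow_left hbase M
      _ ≤ (L n k + n + 2) ^ (12 * a + (2 * c₀ + 4) + M) :=
        Nat.pow_le_pow_right (by omega) (by omega)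
  · rcases Nat.eq_zero_or_pos k with rfl | hk1
    · -- `k = 0`: the jet is the determinant; flatness alone suffices
      have h0 : τ n 0 ≤ (n + 2) ^ c₀ * 2 := by simpa using hF n 0
      calc τ n 0 ≤ (n + 2) ^ c₀ * 2 := h0
        _ ≤ (L n 0 + n + 2) ^ c₀ * (L n 0 + n + 2) :=
          Nat.mul_le_mul (Nat.pow_le_pow_left (by omega) _) hbase
        _ = (L n 0 + n + 2) ^ (c₀ + 1) := by ring
        _ ≤ (L n 0 + n + 2) ^ (12 * a + (2 * c₀ + 4) + M) :=
          Nat.pow_le_pow_right (by omega) (by omega)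
    · -- `1 ≤ k ≤ log₂ n`
      have hn0 : n ≠ 0 := by
        rintro rfl
        rw [Nat.log_zero_right] at hk
        omega
      have h2k : 2 ^ k ≤ n := Nat.pow_le_of_le_log hn0 hk
      have hn2 : 2 ≤ n := by
        have h21 : 2 ^ 1 ≤ 2 ^ k := Nat.pow_le_pow_right (by norm_num) hk1
        have := h21.trans h2k
        simpa using this
      have hklt : k < 2 ^ k := Nat.lt_two_pow_self
      have hfact : Nat.factorial (2 * k + 2) ≤ (2 * n) ^ (2 * k + 2) := by
        calc Nat.factorial (2 * k + 2) ≤ (2 * k + 2) ^ (2 * k + 2) := Nat.factorial_le_pow _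
          _ ≤ (2 * n) ^ (2 * k + 2) := Nat.pow_le_pow_left (by omega) _
      have hflat : (n + 2) ^ (4 * k + c₀) ≤ (2 * n) ^ (4 * k + c₀) :=
        Nat.pow_le_pow_left (by omega) _
      have h1 : τ n k ≤ (2 * n) ^ (6 * k + c₀ + 2) := by
        calc τ n k ≤ (n + 2) ^ (4 * k + c₀) * Nat.factorial (2 * k + 2) := hF n k
          _ ≤ (2 * n) ^ (4 * k + c₀) * (2 * n) ^ (2 * k + 2) := Nat.mul_le_mul hflat hfact
          _ = (2 * n) ^ (6 * k + c₀ + 2) := by ring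
      have hsq : 2 * n ≤ n ^ 2 := by nlinarith
      have h2 : (2 * n) ^ (6 * k + c₀ + 2) ≤ n ^ (12 * k + (2 * c₀ + 4)) := by
        calc (2 * n) ^ (6 * k + c₀ + 2) ≤ (n ^ 2) ^ (6 * k + c₀ + 2) := Nat.pow_le_pow_left hsq _
          _ = n ^ (12 * k + (2 * c₀ + 4)) := by ring
      have hL : n ^ (12 * k) ≤ (L n k + n + 2) ^ (12 * a) := by
        calc n ^ (12 * k) = (n ^ k) ^ 12 := by ring
          _ ≤ ((L n k) ^ a) ^ 12 := Nat.pow_le_pow_left (hG n hn k hk1 hk) _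
          _ = (L n k) ^ (12 * a) := by ring
          _ ≤ (L n k + n + 2) ^ (12 * a) := Nat.pow_le_pow_left (by omega) _
      have hrest : n ^ (2 * c₀ + 4) ≤ (L n k + n + 2) ^ (2 * c₀ + 4) :=
        Nat.pow_le_pow_left (by omega) _
      calc τ n k ≤ n ^ (12 * k + (2 * c₀ + 4)) := h1.trans h2
        _ = n ^ (12 * k) * n ^ (2 * c₀ + 4) := pow_add _ _ _
        _ ≤ (L n k + n + 2) ^ (12 * a) * (L n k + n + 2) ^ (2 * c₀ + 4) :=
          Nat.mul_le_mul hL hrest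
        _ = (L n k + n + 2) ^ (12 * a + (2 * c₀ + 4)) := (pow_add _ _ _).symm
        _ ≤ (L n k + n + 2) ^ (12 * a + (2 * c₀ + 4) + M) :=
          Nat.pow_le_pow_right (by omega) (by omega)

/-- Arithmetic core of `G → X`: a lower bound `n^k ≤ L^a` in the window `1 ≤ k ≤ log₂ n` makes
the exponent of `L` unbounded in `k` (take `k := c·a + 1`). -/
theorem unbounded_of_growth (L : ℕ → ℕ → ℕ) (a n₀ : ℕ)
    (hG : ∀ n : ℕ, n₀ ≤ n → ∀ k : ℕ, 1 ≤ k → k ≤ Nat.log 2 n → n ^ k ≤ (L n k) ^ a) :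
    ∀ c : ℕ, ∃ k : ℕ, ∀ m₀ : ℕ, ∃ n : ℕ, m₀ ≤ n ∧ n ^ c < L n k := by
  intro c
  refine ⟨c * a + 1, fun m₀ => ⟨max (max m₀ n₀) (2 ^ (c * a + 1)), ?_, ?_⟩⟩
  · exact le_trans (le_max_left _ _) (le_max_left _ _)
  · set n := max (max m₀ n₀) (2 ^ (c * a + 1)) with hn
    have hn₀ : n₀ ≤ n := le_trans (le_max_right _ _) (le_max_left _ _)
    have h2k : 2 ^ (c * a + 1) ≤ n := le_max_right _ _
    have hklog : c * a + 1 ≤ Nat.log 2 n := Nat.le_log_of_pow_le (by norm_num) h2k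
    have hn2 : 2 ≤ n := by
      have h21 : 2 ^ 1 ≤ 2 ^ (c * a + 1) := Nat.pow_le_pow_right (by norm_num) (by omega)
      have := h21.trans h2k
      simpa using this
    have hGn := hG n hn₀ (c * a + 1) (by omega) hklog
    -- if `L ≤ n^c` then `n^(ca+1) ≤ L^a ≤ n^(ca)`, absurd for `n ≥ 2`
    refine Nat.not_le.mp fun hle => ?_
    have hchain : n ^ (c * a + 1) ≤ n ^ (c * a) := by
      calc n ^ (c * a + 1) ≤ (L n (c * a + 1)) ^ a := hGn
        _ ≤ (n ^ c) ^ a := Nat.pow_le_pow_left hle _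
        _ = n ^ (c * a) := by ring
    have : n ^ (c * a) < n ^ (c * a + 1) := Nat.pow_lt_pow_right (by omega) (by omega)
    omega

/-- Arithmetic core of `CE → CF → X` — verbatim the arithmetic of the certified `closes`. -/
theorem unbounded_of_elim_of_cfGrowth (τ L : ℕ → ℕ → ℕ) (b : ℕ)
    (hE : ∀ n k : ℕ, k ≤ Nat.log 2 n → τ n k ≤ (L n k + n + 2) ^ b)
    (hCF : ∀ c : ℕ, ∃ k : ℕ, 1 ≤ k ∧ ∀ n₀ : ℕ, ∃ n : ℕ, n₀ ≤ n ∧ n ^ c ≤ τ n k) :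
    ∀ c : ℕ, ∃ k : ℕ, ∀ n₀ : ℕ, ∃ n : ℕ, n₀ ≤ n ∧ n ^ c < L n k := by
  intro c
  obtain ⟨k, hk1, hk⟩ := hCF ((c + 2) * b + 1)
  refine ⟨k, fun n₀ => ?_⟩
  obtain ⟨n, hn, hτ⟩ := hk (max n₀ (max (2 ^ k) 3))
  refine ⟨n, le_trans (le_max_left _ _) hn, ?_⟩
  have h2k : 2 ^ k ≤ n := le_trans (le_trans (le_max_left _ _) (le_max_right _ _)) hn
  have h3 : 3 ≤ n := le_trans (le_trans (le_max_right _ _) (le_max_right _ _)) hn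
  have hklog : k ≤ Nat.log 2 n := Nat.le_log_of_pow_le (by norm_num) h2k
  have hCEn := hE n k hklog
  refine Nat.not_le.mp fun hUn => ?_
  have hn1 : 1 ≤ n := by omega
  have hpow1 : n ≤ n ^ (c + 1) := by
    calc n = n ^ 1 := (pow_one n).symm
      _ ≤ n ^ (c + 1) := Nat.pow_le_pow_right hn1 (by omega)
  have hpow2 : n ^ c ≤ n ^ (c + 1) := Nat.pow_le_pow_right hn1 (by omega)
  have hpow3 : (2 : ℕ) ≤ n ^ (c + 1) := le_trans (by omega : 2 ≤ n) hpow1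
  have hsum : L n k + n + 2 ≤ n ^ (c + 2) := by
    have : L n k + n + 2 ≤ 3 * n ^ (c + 1) := by omega
    calc L n k + n + 2 ≤ 3 * n ^ (c + 1) := this
      _ ≤ n * n ^ (c + 1) := Nat.mul_le_mul_right _ h3
      _ = n ^ (c + 2) := by ring
  have hchain : n ^ ((c + 2) * b + 1) ≤ n ^ ((c + 2) * b) := by
    calc n ^ ((c + 2) * b + 1) ≤ τ n k := hτ
      _ ≤ (L n k + n + 2) ^ b := hCEn
      _ ≤ (n ^ (c + 2)) ^ b := Nat.pow_le_pow_left hsum b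
      _ = n ^ ((c + 2) * b) := by rw [← pow_mul]
  have hlt : n ^ ((c + 2) * b) < n ^ ((c + 2) * b + 1) :=
    Nat.pow_lt_pow_right (by omega) (by omega)
  omega

/-- Arithmetic core of `X → U → VH`: an unbounded exponent contradicts a uniform `n^c` bound. -/
theorem false_of_unbounded_of_uniform (L : ℕ → ℕ → ℕ) (c n₀ : ℕ)
    (hX : ∀ c : ℕ, ∃ k : ℕ, ∀ n₀ : ℕ, ∃ n : ℕ, n₀ ≤ n ∧ n ^ c < L n k)
    (hU : ∀ n : ℕ, n₀ ≤ n → ∀ k : ℕ, L n k ≤ n ^ c) : False := by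
  obtain ⟨k, hk⟩ := hX c
  obtain ⟨n, hn, hlt⟩ := hk n₀
  exact absurd (hU n hn k) (not_le.mpr hlt)

/-! ## The sandwich, stated on the route's own declarations -/

/-- (A) The deciding crux is implied by the route's own split-free milestone `JetCostGrowthC`
(a complex lower bound on the jets) modulo the routine flatness bound. -/
theorem jetConstantElim_of_flat_of_growthC : JetFlatness → JetCostGrowthC → JetConstantElim := by
  rw [jetFlatness_iff, jetCostGrowthC_iff, jetConstantElim_iff]
  rintro ⟨c₀, hF⟩ ⟨a, n₀, hG⟩
  exact elim_of_flat_of_growth tau ell c₀ a n₀ hF hG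

/-- (A') … and that milestone alone already gives the route's target. -/
theorem jetExponentUnbounded_of_growthC : JetCostGrowthC → JetExponentUnbounded := by
  rw [jetCostGrowthC_iff, jetExponentUnbounded_iff]
  rintro ⟨a, n₀, hG⟩
  exact unbounded_of_growth ell a n₀ hG

/-- (B) The two cruxes `CE`, `CF` are jointly exactly the target `X` (the `closes` arithmetic). -/
theorem jetExponentUnbounded_of_elim_of_cfGrowth :
    JetConstantElim → ConstantFreeJetGrowth → JetExponentUnbounded := by
  rw [jetConstantElim_iff, constantFreeJetGrowth_iff, jetExponentUnbounded_iff]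
  rintro ⟨b, hE⟩ hCF
  exact unbounded_of_elim_of_cfGrowth tau ell b hE hCF

/-- (C) Target plus the conditional upper bound give the summit. -/
theorem valiantsHypothesis_of_unbounded_of_uniform :
    JetExponentUnbounded → UniformJetUpperBound → _root_.ValiantsHypothesis := by
  rw [jetExponentUnbounded_iff, uniformJetUpperBound_iff]
  intro hX hU
  show VP ℂ ≠ VNP ℂ
  intro hEq
  obtain ⟨c, n₀, hc⟩ := hU hEq
  exact false_of_unbounded_of_uniform ell c n₀ hX hc

/-- (D) Under the collapse `VP ℂ = VNP ℂ` (the only world in which the route's conditional crux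
`U` has content), the deciding crux `CE` forces the FAILURE of its sibling crux `CF`:
`CE` is there equivalent to "constant-free jets are uniformly polynomial", i.e. to `¬CF`-type
statements — the split `CF ∧ CE` of the target is a conjunct split with no slack. -/
theorem not_cfGrowth_of_elim_of_collapse (hCE : JetConstantElim) (hU : UniformJetUpperBound)
    (hEq : VP ℂ = VNP ℂ) : ¬ ConstantFreeJetGrowth := fun hCF =>
  valiantsHypothesis_of_unbounded_of_uniform
    (jetExponentUnbounded_of_elim_of_cfGrowth hCE hCF) hU hEq

/-- (E) Conversely to (A) at fixed order: every FIXED-`k` truncation of the deciding crux is a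
triviality given flatness — the content of `CE` is only the uniformity in `k ≤ log₂ n`.
(Witness exponent `b := 4k + c₀ + (2k+2)!`, using `n + 2 ≤ L + n + 2`.) -/
theorem jetConstantElim_fixedOrder (hF : JetFlatness) (k : ℕ) :
    ∃ b : ℕ, ∀ n : ℕ, tau n k ≤ (ell n k + n + 2) ^ b := by
  rw [jetFlatness_iff] at hF
  obtain ⟨c₀, hF⟩ := hF
  refine ⟨4 * k + c₀ + Nat.factorial (2 * k + 2), fun n => ?_⟩
  have hbase : 2 ≤ ell n k + n + 2 := by omega
  calc tau n k ≤ (n + 2) ^ (4 * k + c₀) * Nat.factorial (2 * k + 2) := hF n k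
    _ ≤ (ell n k + n + 2) ^ (4 * k + c₀) * (ell n k + n + 2) ^ Nat.factorial (2 * k + 2) := by
      apply Nat.mul_le_mul (Nat.pow_le_pow_left (by omega) _)
      exact le_trans (Nat.lt_two_pow_self).le (Nat.pow_le_pow_left hbase _)
    _ = (ell n k + n + 2) ^ (4 * k + c₀ + Nat.factorial (2 * k + 2)) := (pow_add _ _ _).symm


/-- "constant-free jets of logarithmic order are uniformly polynomial": the conclusion any proof of
`CE` reaches if it bounds `τ` WITHOUT using the complex circuit behind `L` (the only unconditional
handle on `τ(J n k)` in print is an explicit constant-free construction, cf. `JetFlatness`). -/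
def UniformTauBound : Prop :=
  ∃ b n₀ : ℕ, ∀ n : ℕ, n₀ ≤ n → ∀ k : ℕ, k ≤ Nat.log 2 n → tau n k ≤ n ^ b

/-- (F) The dichotomy behind the census: a uniform constant-free upper bound on the window — the
circuit-free way of making `CE` true — REFUTES the sibling crux `CF`.  Hence any proof of `CE`
compatible with the route must extract `τ`-information from near-optimal COMPLEX circuits of the
jets uniformly in `k` (constant elimination proper, no technique in print) or from lower bounds on
`L` (the `G`-side, (A)/(A')). -/
theorem not_cfGrowth_of_uniformTau : UniformTauBound → ¬ ConstantFreeJetGrowth := by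
  rintro ⟨b, n₀, hB⟩ hCF
  rw [constantFreeJetGrowth_iff] at hCF
  obtain ⟨k, hk1, hk⟩ := hCF (b + 1)
  obtain ⟨n, hn, hτ⟩ := hk (max n₀ (max (2 ^ k) 2))
  have hn₀ : n₀ ≤ n := le_trans (le_max_left _ _) hn
  have h2k : 2 ^ k ≤ n := le_trans (le_trans (le_max_left _ _) (le_max_right _ _)) hn
  have hn2 : 2 ≤ n := le_trans (le_trans (le_max_right _ _) (le_max_right _ _)) hn
  have hklog : k ≤ Nat.log 2 n := Nat.le_log_of_pow_le (by norm_num) h2k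
  have h1 : n ^ (b + 1) ≤ n ^ b := hτ.trans (hB n hn₀ k hklog)
  have h2 : n ^ b < n ^ (b + 1) := Nat.pow_lt_pow_right (by omega) (by omega)
  omega

/-- (F') … while `CE` itself follows from such a bound for free (`n ≤ L + n + 2`). -/
theorem jetConstantElim_of_uniformTau (hF : JetFlatness) : UniformTauBound → JetConstantElim := by
  rintro ⟨b, n₀, hB⟩
  rw [jetConstantElim_iff]
  -- reuse (A)'s arithmetic with the trivial "lower bound" `n^k ≤ (n^b·?)`: simpler to redo directly
  rw [jetFlatness_iff] at hF
  obtain ⟨c₀, hF⟩ := hF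
  -- small `n < n₀`: flat bound by a constant `M ≤ 2^M ≤ (L+n+2)^M`; large `n`: `τ ≤ n^b ≤ (L+n+2)^b`
  obtain ⟨M, hM⟩ : ∃ M : ℕ, ∀ n k : ℕ, n < n₀ → k ≤ n → tau n k ≤ M := by
    refine ⟨(n₀ + 2) ^ (4 * n₀ + c₀) * Nat.factorial (2 * n₀ + 2), fun n k hn hk => ?_⟩
    calc tau n k ≤ (n + 2) ^ (4 * k + c₀) * Nat.factorial (2 * k + 2) := hF n k
      _ ≤ (n₀ + 2) ^ (4 * n₀ + c₀) * Nat.factorial (2 * n₀ + 2) := by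
        apply Nat.mul_le_mul
        · calc (n + 2) ^ (4 * k + c₀) ≤ (n₀ + 2) ^ (4 * k + c₀) := Nat.pow_le_pow_left (by omega) _
            _ ≤ (n₀ + 2) ^ (4 * n₀ + c₀) := Nat.pow_le_pow_right (by omega) (by omega)
        · exact Nat.factorial_le (by omega)
  refine ⟨b + M, fun n k hk => ?_⟩
  have hbase : 2 ≤ ell n k + n + 2 := by omega
  have hkn : k ≤ n := hk.trans (Nat.log_le_self 2 n)
  rcases Nat.lt_or_ge n n₀ with hn | hn
  · calc tau n k ≤ M := hM n k hn hkn
      _ ≤ 2 ^ M := (Nat.lt_two_pow_self).le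
      _ ≤ (ell n k + n + 2) ^ M := Nat.pow_le_pow_left hbase M
      _ ≤ (ell n k + n + 2) ^ (b + M) := Nat.pow_le_pow_right (by omega) (by omega)
  · calc tau n k ≤ n ^ b := hB n hn k hk
      _ ≤ (ell n k + n + 2) ^ b := Nat.pow_le_pow_left (by omega) _
      _ ≤ (ell n k + n + 2) ^ (b + M) := Nat.pow_le_pow_right (by omega) (by omega)

end Summit.ValiantsHypothesis.ValiantsHypothesis.Cruxes.JetConstantElim.Strategist
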